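import Summits.AtomisticToContinuum.BoseEinsteinCondensation.Theorems.PeriodicIRBound.Negative.FreeGas
import Literature.Barriers.AtomisticToContinuum.KineticGapLengthScalesFreeGas

/-!
# Negative lemmas for crux `PeriodicIRBound` (stmt-AtomisticToContinuum-3972), IV: the crux as a
bound on ground-state occupations; the side condition `k ≠ 0`

Supports (does not close) stmt-AtomisticToContinuum-3972, route `BECGroundStateSOS`. Landed copy of
§11–§12 of `Cruxes/PeriodicIRBound/Disproof.lean` (cycle 1); all `sorry`-free.

* §11 `irBoundFor_iff_ground` — per potential the crux is EQUIVALENT (factor `2` in `C`) to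
  `∀ κ ∃ ρ₀ ∃ C ∀ ρ<ρ₀ ∀ᶠ N ∀ k ∈ window, groundOccupation v N L_N k ≤ C√ρ L_N/‖k‖_∞`, where
  `groundOccupation = ⨅_{δ>0} ⨆_{δ-near-minimisers} n_k` (the `sup`-twin of `condensateNumber`): the
  `∃ δ ∀ Ψ` layer carries no content (finite window `inWindow_mem_box`, least slack over it).
* §12 `periodicIRBound_false_withZeroMode` — dropping `k ≠ 0` makes the crux false only through
  `x / 0 = 0` (bound `0` at `k = 0` vs `n₀ = N` for the free ground state).
-/

noncomputable section

open MeasureTheory Filter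
open scoped ENNReal NNReal ComplexConjugate BigOperators
namespace Summit.AtomisticToContinuum.BoseEinsteinCondensation.Theorems.PeriodicIRBound.Negative

open Literature.MathematicalPhysics.QuantumManyBody.BoseGas
open Summit.AtomisticToContinuum.BoseEinsteinCondensation.Theses.BECGroundStateSOS
open Summit.AtomisticToContinuum.BoseEinsteinCondensation.Theorems.GaussianDominationCan.Negative
  (symState symFun oneBody periodicEnergy_symState nsq nsq_nonneg e0 e0_ne_zero norm_e0
    nsq_e0 one_le_norm_intVec lintegral_nnnorm_sq_prodFun lintegral_nnnorm_sq_oneBody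
    continuous_oneBody integral_cell_const conj_cellWave_mul_self integral_cell_conj_cellWave
    isRepulsiveFiniteRange_zero)
open Summit.AtomisticToContinuum.BoseEinsteinCondensation.Theorems.GaussianDominationCan.Negative
  renaming prodFun → gdProd
open Summit.AtomisticToContinuum.BoseEinsteinCondensation.Theorems.CorrectorClosure.Negative
  (hardCore isRepulsiveFiniteRange_hardCore periodicEnergy_hardCore_eq_top
    periodicGroundStateEnergy_one_eq_top)

variable {L : ℝ} {m : ℕ} {n : Fin 3 → ℤ} {a b : ℝ}

/-! ## §11 REFORMULATION: the crux is a bound on the GROUND-STATE occupations `γ_N(k)` -/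

/-- The **ground-state occupation** of the plane wave `k` at `(N, L)`: the worst-case occupation
`n_k(Ψ)` among `δ`-near-minimisers, in the limit `δ ↓ 0` —
`γ(k) = inf_{δ>0} sup {n_k(Ψ) : ⟨Ψ,HΨ⟩ ≤ E₀^{per} + δ}` (the `sup`-twin of `condensateNumber`). For
fixed `(N, L)` (compact resolvent, Perron–Frobenius-unique ground state `Ψ₀`) this is `n_k(Ψ₀)`;
nothing below uses that. -/
def groundOccupation (v : ℝ → ℝ≥0∞) (N : ℕ) (L : ℝ) (k : Fin 3 → ℤ) : ℝ≥0∞ :=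
  ⨅ (δ : ℝ≥0∞) (_ : 0 < δ), ⨆ (Ψ : PeriodicTrialState N L)
    (_ : periodicEnergy v Ψ ≤ periodicGroundStateEnergy v N L + δ),
      cellOccupation N L (planeWaveMode L k) Ψ.ψ

/-- `γ(k) ≤ N`. [folklore] -/
theorem groundOccupation_le {v : ℝ → ℝ≥0∞} {N : ℕ} (hL : 0 < L) (k : Fin 3 → ℤ) :
    groundOccupation v N L k ≤ N :=
  (iInf₂_le (1 : ℝ≥0∞) one_pos).trans (iSup₂_le fun Ψ _ => Ψ.cellOccupation_planeWaveMode_le hL k)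

/-- The crux for one potential as a bound on ground-state occupations: NO slack `δ`, NO state
quantifier. -/
def GroundIRBoundWith (v : ℝ → ℝ≥0∞) (κ ρ₀ C : ℝ) : Prop :=
  ∀ ρ : ℝ, 0 < ρ → ρ < ρ₀ → ∀ᶠ N : ℕ in atTop, ∀ k : Fin 3 → ℤ, InWindow κ ρ N k →
    groundOccupation v N (sideLength ρ N) k ≤
      ENNReal.ofReal (C * Real.sqrt ρ * sideLength ρ N / ‖(fun j => (k j : ℝ))‖)

/-- `IRBoundWith ⇒ GroundIRBoundWith` with the same constants. [folklore] -/
theorem groundIRBoundWith_of {v : ℝ → ℝ≥0∞} {κ ρ₀ C : ℝ} (h : IRBoundWith v κ ρ₀ C) :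
    GroundIRBoundWith v κ ρ₀ C := by
  intro ρ hρ hρρ₀
  filter_upwards [h ρ hρ hρρ₀] with N ⟨δ, hδ, hN⟩ k hk
  refine (iInf₂_le δ hδ).trans (iSup₂_le fun Ψ hΨ => ?_)
  have := hN Ψ hΨ k hk
  rwa [irIneq_iff] at this

/-- The window is contained in the finite box `[-R, R]³`, `R = ⌈κ√ρ L_N⌉`. [folklore] -/
theorem inWindow_mem_box {κ ρ : ℝ} {N : ℕ} {k : Fin 3 → ℤ} (hk : InWindow κ ρ N k) :
    k ∈ Fintype.piFinset fun _ : Fin 3 =>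
      Finset.Icc (-((⌈κ * Real.sqrt ρ * sideLength ρ N⌉₊ : ℕ) : ℤ))
        ((⌈κ * Real.sqrt ρ * sideLength ρ N⌉₊ : ℕ) : ℤ) := by
  rw [Fintype.mem_piFinset]
  intro j
  rw [Finset.mem_Icc]
  have h1 : |(k j : ℝ)| ≤ ‖(fun j => (k j : ℝ))‖ := by
    have := norm_le_pi_norm (fun j => (k j : ℝ)) j
    rwa [Real.norm_eq_abs] at this
  have h2 : |(k j : ℝ)| ≤ ((⌈κ * Real.sqrt ρ * sideLength ρ N⌉₊ : ℕ) : ℝ) :=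
    (h1.trans hk.2).trans (Nat.le_ceil _)
  have h3 : |k j| ≤ ((⌈κ * Real.sqrt ρ * sideLength ρ N⌉₊ : ℕ) : ℤ) := by exact_mod_cast h2
  exact ⟨(abs_le.1 h3).1, (abs_le.1 h3).2⟩

/-- **`GroundIRBoundWith ⇒ IRBoundWith` at the cost of a factor `2` in `C`.** For each of the
finitely many modes of the window pick a slack `δ_k` at which the `sup` is within a factor `2` of its
limit, and take the least one. [folklore] -/
theorem irBoundWith_of_ground {v : ℝ → ℝ≥0∞} {κ ρ₀ C : ℝ} (hC : 0 < C)
    (h : GroundIRBoundWith v κ ρ₀ C) : IRBoundWith v κ ρ₀ (2 * C) := by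
  intro ρ hρ hρρ₀
  filter_upwards [h ρ hρ hρρ₀, eventually_gt_atTop 0] with N hN hNpos
  have hL := sideLength_pos_of_pos hρ hNpos
  -- a slack for each mode
  have hk : ∀ k : Fin 3 → ℤ, ∃ δ : ℝ≥0∞, 0 < δ ∧ (InWindow κ ρ N k →
      ∀ Ψ : PeriodicTrialState N (sideLength ρ N), NearMin v ρ N δ Ψ → IRIneq (2 * C) ρ N Ψ.ψ k) := by
    intro k
    by_cases hkw : InWindow κ ρ N k
    · have hnorm := one_le_norm_intVec hkw.1
      have hB : 0 < C * Real.sqrt ρ * sideLength ρ N / ‖(fun j => (k j : ℝ))‖ :=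
        div_pos (by positivity) (by linarith)
      have hlt : groundOccupation v N (sideLength ρ N) k <
          ENNReal.ofReal (2 * C * Real.sqrt ρ * sideLength ρ N / ‖(fun j => (k j : ℝ))‖) := by
        refine (hN k hkw).trans_lt ?_
        rw [ENNReal.ofReal_lt_ofReal_iff (by positivity)]
        have : 2 * C * Real.sqrt ρ * sideLength ρ N / ‖(fun j => (k j : ℝ))‖ =
            2 * (C * Real.sqrt ρ * sideLength ρ N / ‖(fun j => (k j : ℝ))‖) := by ring
        rw [this]
        linarith
      obtain ⟨δ, hδlt⟩ := iInf_lt_iff.1 hlt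
      obtain ⟨hδ, hsup⟩ := iInf_lt_iff.1 hδlt
      refine ⟨δ, hδ, fun _ Ψ hΨ => ?_⟩
      rw [irIneq_iff]
      exact (le_iSup₂_of_le (f := fun (Φ : PeriodicTrialState N (sideLength ρ N))
        (_ : periodicEnergy v Φ ≤ periodicGroundStateEnergy v N (sideLength ρ N) + δ) =>
          cellOccupation N (sideLength ρ N) (planeWaveMode (sideLength ρ N) k) Φ.ψ) Ψ hΨ le_rfl).trans
        hsup.le
    · exact ⟨1, one_pos, fun h' => (hkw h').elim⟩
  choose δf hδf hprop using hk
  -- the least slack over the finite box containing the window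
  set W : Finset (Fin 3 → ℤ) := Fintype.piFinset fun _ : Fin 3 =>
      Finset.Icc (-((⌈κ * Real.sqrt ρ * sideLength ρ N⌉₊ : ℕ) : ℤ))
        ((⌈κ * Real.sqrt ρ * sideLength ρ N⌉₊ : ℕ) : ℤ) with hW
  have hW0 : (0 : Fin 3 → ℤ) ∈ W := by
    rw [hW, Fintype.mem_piFinset]
    intro j
    simp
  have hWne : W.Nonempty := ⟨0, hW0⟩
  refine ⟨W.inf' hWne δf, (Finset.lt_inf'_iff hWne).2 fun k _ => hδf k, fun Ψ hΨ k hkw => ?_⟩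
  have hmem : k ∈ W := inWindow_mem_box hkw
  have hle : W.inf' hWne δf ≤ δf k := Finset.inf'_le _ hmem
  exact hprop k hkw Ψ (hΨ.trans (add_le_add le_rfl hle))

/-- **The crux, per potential, is EQUIVALENT (up to a factor 2 in `C`) to a bound on the ground-state
occupations**: `IRBoundFor v ↔ ∀ κ>0 ∃ ρ₀>0 ∃ C>0 ∀ ρ<ρ₀ ∀ᶠ N ∀ k ∈ window,
γ_N(k) ≤ C√ρ L_N/‖k‖_∞`. The `∃ δ ∀ Ψ` layer of the crux carries no extra content. [folklore] -/
theorem irBoundFor_iff_ground (v : ℝ → ℝ≥0∞) :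
    IRBoundFor v ↔ ∀ κ : ℝ, 0 < κ → ∃ ρ₀ : ℝ, 0 < ρ₀ ∧ ∃ C : ℝ, 0 < C ∧ GroundIRBoundWith v κ ρ₀ C := by
  constructor
  · intro h κ hκ
    obtain ⟨ρ₀, hρ₀, C, hC, h⟩ := h κ hκ
    exact ⟨ρ₀, hρ₀, C, hC, groundIRBoundWith_of h⟩
  · intro h κ hκ
    obtain ⟨ρ₀, hρ₀, C, hC, h⟩ := h κ hκ
    exact ⟨ρ₀, hρ₀, 2 * C, by positivity, irBoundWith_of_ground hC h⟩

/-! ## §12 The side condition `k ≠ 0` (a junk-division artefact) -/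

/-- The crux with the mode condition `k ≠ 0` DROPPED (window `‖k‖_∞ ≤ κ√ρ L_N` only). -/
def PeriodicIRBoundWithZeroMode : Prop :=
  ∀ v : ℝ → ℝ≥0∞, IsRepulsiveFiniteRange v → ∀ κ : ℝ, 0 < κ → ∃ ρ₀ : ℝ, 0 < ρ₀ ∧ ∃ C : ℝ, 0 < C ∧
    ∀ ρ : ℝ, 0 < ρ → ρ < ρ₀ → ∀ᶠ N : ℕ in atTop, ∃ δ : ℝ≥0∞, 0 < δ ∧
      ∀ Ψ : PeriodicTrialState N (sideLength ρ N), NearMin v ρ N δ Ψ → ∀ k : Fin 3 → ℤ,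
        ‖(fun j => (k j : ℝ))‖ ≤ κ * Real.sqrt ρ * sideLength ρ N → IRIneq C ρ N Ψ.ψ k

/-- **`k ≠ 0` is needed, but only because `x / 0 = 0` in Lean**: at `k = 0` the bound reads
`n₀ ≤ ofReal (C√ρL/0) = 0`, while the free ground state (the constant state `twoMode 0`) is a
near-minimiser with `n₀ = N`. Any restatement must keep `k ≠ 0` (or use the product form
`‖k‖ · n_k ≤ C√ρ L`). [folklore] -/
theorem periodicIRBound_false_withZeroMode : ¬ PeriodicIRBoundWithZeroMode := by
  intro h
  obtain ⟨ρ₀, hρ₀, C, _hC, h⟩ := h 0 isRepulsiveFiniteRange_zero 1 one_pos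
  have hρ : (0 : ℝ) < ρ₀ / 2 := by positivity
  obtain ⟨Cgap, _hCgap, hgap⟩ :=
    Literature.Barriers.AtomisticToContinuum.BoseGas.natCast_le_condensateOccupation_add
  obtain ⟨N, ⟨δ, _hδ, hN⟩, hN2⟩ := ((h (ρ₀ / 2) hρ (by linarith)).and (eventually_ge_atTop 2)).exists
  obtain ⟨m, rfl⟩ : ∃ m, N = m + 1 := ⟨N - 1, by omega⟩
  have hL := sideLength_pos_of_pos hρ (by omega : 0 < m + 1)
  -- the constant state is a near-minimiser of the free gas …
  have hnear : NearMin 0 (ρ₀ / 2) (m + 1) δ (twoMode m hL e0_ne_zero 0 le_rfl zero_le_one) := by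
    unfold NearMin
    rw [periodicEnergy_zero_twoMode hL e0_ne_zero le_rfl zero_le_one]
    simp
  -- … with `n₀ = N`
  have key := hN _ hnear 0 (by simp; positivity)
  rw [irIneq_iff, cellOccupation_planeWaveMode_zero] at key
  have h0 : ‖(fun j => (((0 : Fin 3 → ℤ) j : ℤ) : ℝ))‖ = 0 := by simp
  rw [h0, div_zero, ENNReal.ofReal_zero, nonpos_iff_eq_zero] at key
  have hocc := hgap (m + 1) (sideLength (ρ₀ / 2) (m + 1)) (by omega) hL 0
    (twoMode m hL e0_ne_zero 0 le_rfl zero_le_one)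
  rw [key, zero_add, periodicEnergy_zero_twoMode hL e0_ne_zero le_rfl zero_le_one] at hocc
  simp at hocc

end Summit.AtomisticToContinuum.BoseEinsteinCondensation.Theorems.PeriodicIRBound.Negative

end
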